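import Mathlib
import HarnessLib
import Summits.Ventures.LatticeQCDFlow.Exactness.EngineHMCTranslationCovariance
import Summits.Ventures.LatticeQCDFlow.Scoring.HMCKernelChargeConjugation

/-!
# Row 21's HMC arms as run commute with charge conjugation: the coordinate involution `(d, R, I) ↦ (−d, R, −I)` of the engine's `𝔰𝔲(N)` coordinates; `E_t[Im tr W] = 0` for every line and plaquette at every step from the cold or hot start

HONEST FRAMING: exact (Metropolis-corrected) sampling algorithms for lattice gauge theory;
figures of merit are autocorrelation/cost numbers at stated couplings and volumes; no
continuum-physics claim.

Venture `LatticeQCDFlow` (cell pub-lqcd), topic `Exactness`, FANOUT row 21 (`su3-base`, arms `E2 = PBC-HMC` and `OBC-HMC` AS RUN,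
row 9's engine kernel `sunLeapfrogHMCN`).  NEW WORK of the cell: the charge-conjugation twin of row 21's
`EngineHMCTranslationCovariance` / `EngineHMCCenterSymmetry`.  Here the symmetry acts on the links by entrywise conjugation
(`configConj N`, row 21's `GlobalAutomorphismSymmetry`) AND on the momenta, through a linear involution of row 9's coordinates
`SUNCoords N = zeroSum × (ℝ^{pairs} × ℝ^{pairs})`: conjugating the skew-Hermitian matrix `X` (diagonal `i d`, upper `R + iI`)
gives diagonal `−i d`, upper `R − iI`, i.e. the coordinates `(−d, R, −I)`.  Row 21's `Scoring/HMCKernelChargeConjugation` is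
the statement for row 16's kernel (its `exp_mapConj`, `suProj_mapConj`, `plaquetteLoopSum_configConj`, `coe_suConjAut`,
`dirac_one_map_configConj`, `piHaar_map_configConj` are used by name).  Two definitions (`sunCoordConj`, `sunMomConj`);
nothing is cited as a fact; no number.

* §1 **`sunCoordConj`** (a linear involution of `SUNCoords N`), `sunCoordι_sunCoordConj` (`ι(R c) = conj (ι c)`),
  `coordOf_mapConj`, `sunCoordQuad_sunCoordConj` (the kinetic energy is blind to it), `suExp_sunCoordConj` (`e^{ι(Rc)} = conj e^{ι c}`),
  `map_sunCoordConj_addHaar` (`|det R| = 1`: Lebesgue measure is preserved); **`sunMomConj`** (link by link) and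
  `sunMomentumLaw_map_sunMomConj`.
* §2 `sunLeapfrogProposalN_configConj` — for every increment with `g(Ū) = R ∘ g(U)`: `Ψ_n(Ū, Rp) = (conj Ψ_n(U,p)₁, R Ψ_n(U,p)₂)`;
  **`conjKernel_sunLeapfrogHMCN_of_configConj`**.
* §3 `sunWilsonForce_configConj`, `weightedLoopSum_configConj`, `sunWeightedForce_configConj` (the forces are conjugation
  equivariant); **`conjKernel_wilsonForce_sunLeapfrogHMCN_configConj`**, **`conjKernel_obcForce_sunLeapfrogHMCN_configConj`**.
* §4 `integral_im_trace_eq_zero_of_map_configConj` (order-parameter mechanism); at every step from the cold or hot start (both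
  conjugation invariant): **`integral_wilsonHmcChain_im_trace_eq_zero_of_equivariant`**
  and the OBC twin — `E_t[Im tr W] = 0` for every conjugation-equivariant `SU(N)`-valued field function `W` (links, plaquettes,
  straight / Polyakov lines: `integral_wilsonHmcColdStart_im_trace_lineHolonomy_eq_zero`, `…HotStart…`, `…obcHmc…`).
NOT CLAIMED: reflections; stationarity; numbers.
-/

noncomputable section

namespace Summit.Ventures.LatticeQCDFlow.Exactness

open MeasureTheory ProbabilityTheory ProbabilityTheory.Kernel Set Function
open Literature.MathematicalPhysics.QuantumFieldTheory
open Literature.MathematicalPhysics.QuantumLattice (fundamentalRep)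
open scoped ENNReal Matrix ComplexConjugate

set_option backward.isDefEq.respectTransparency false

variable (N : ℕ)

local notation "𝐂" => (RingHom.mapMatrix (starRingEnd ℂ) : Matrix (Fin N) (Fin N) ℂ →+* Matrix (Fin N) (Fin N) ℂ)

/-! ## §1 The coordinate involution of charge conjugation -/

/-- **Charge conjugation in the engine's coordinates of `𝔰𝔲(N)`**: `(d, R, I) ↦ (−d, R, −I)`, a linear involution. -/
def sunCoordConj : SUNCoords N ≃ₗ[ℝ] SUNCoords N :=
  (LinearEquiv.neg ℝ).prodCongr ((LinearEquiv.refl ℝ (UpperPair N → ℝ)).prodCongr (LinearEquiv.neg ℝ))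

/-- Pointwise formula. -/
@[simp] theorem sunCoordConj_apply (c : SUNCoords N) : sunCoordConj N c = (-c.1, (c.2.1, -c.2.2)) := rfl

/-- `sunCoordConj` is an involution. -/
theorem sunCoordConj_sunCoordConj (c : SUNCoords N) : sunCoordConj N (sunCoordConj N c) = c := by
  simp only [sunCoordConj_apply, neg_neg]

/-- **`ι(R c) = conj (ι c)`**: the involution is entrywise conjugation read in coordinates. -/
theorem sunCoordι_sunCoordConj (c : SUNCoords N) : sunCoordι N (sunCoordConj N c) = 𝐂 (sunCoordι N c) := by
  ext i j
  rw [RingHom.mapMatrix_apply, Matrix.map_apply, sunCoordι_apply, sunCoordι_apply, sunCoordConj_apply]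
  simp only [Submodule.coe_neg]
  rcases lt_trichotomy i j with h | rfl | h
  · rw [sunCoordMatrix_apply_of_lt _ _ _ _ h, sunCoordMatrix_apply_of_lt _ _ _ _ h]
    simp only [Pi.neg_apply, map_add, map_mul, Complex.conj_ofReal, Complex.conj_I, Complex.ofReal_neg]
    ring
  · rw [sunCoordMatrix_apply_self, sunCoordMatrix_apply_self]
    simp only [Pi.neg_apply, map_mul, Complex.conj_ofReal, Complex.conj_I, Complex.ofReal_neg]
    ring
  · rw [sunCoordMatrix_apply_of_gt _ _ _ _ h, sunCoordMatrix_apply_of_gt _ _ _ _ h]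
    simp only [Pi.neg_apply, map_add, map_neg, map_mul, Complex.conj_ofReal, Complex.conj_I, Complex.ofReal_neg]
    ring

/-- **Coordinates of a conjugated matrix**: `coordOf (conj X) = R (coordOf X)` for skew-Hermitian traceless `X`. -/
theorem coordOf_mapConj (X : Matrix (Fin N) (Fin N) ℂ) (hX : Xᴴ = -X) (hX0 : X.trace = 0) :
    coordOf (sunCoordι N) (sunCoordι_injective N) (𝐂 X) = sunCoordConj N (coordOf (sunCoordι N) (sunCoordι_injective N) X) := by
  obtain ⟨c, rfl⟩ := LinearMap.mem_range.1 (sunCoordι_range N X hX hX0)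
  rw [← sunCoordι_sunCoordConj, coordOf_apply, coordOf_apply]

/-- **The kinetic quadratic form is blind to the involution**: `q(R c) = q(c)`. -/
theorem sunCoordQuad_sunCoordConj (c : SUNCoords N) : sunCoordQuad N (sunCoordConj N c) = sunCoordQuad N c := by
  simp only [sunCoordQuad, sunCoordConj_apply, Submodule.coe_neg, Pi.neg_apply, neg_sq]

/-- Hence the engine's kinetic energy is blind to the link-wise involution. -/
theorem sunKinetic_sunCoordConj {Lk : Type*} [Fintype Lk] (p : Lk → SUNCoords N) :
    sunKinetic N (fun l => sunCoordConj N (p l)) = sunKinetic N p := by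
  simp only [sunKinetic, sunCoordQuad_sunCoordConj]

/-- **`e^{ι(R c)} = conj (e^{ι c})`** in `SU(N)`. -/
theorem suExp_sunCoordConj (c : SUNCoords N) :
    suExp (sunCoordι N) (sunCoordι_skew N) (sunCoordConj N c) = suConjAut N (suExp (sunCoordι N) (sunCoordι_skew N) c) := by
  apply Subtype.ext
  rw [coe_suExp, sunCoordι_sunCoordConj, Scoring.coe_suConjAut, coe_suExp]
  exact Scoring.exp_mapConj (sunCoordι N c)

/-- **Lebesgue measure on the coordinates is preserved** (`R ∘ R = id`, so `|det R| = 1`). -/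
theorem map_sunCoordConj_addHaar :
    (Measure.addHaar : Measure (SUNCoords N)).map (sunCoordConj N) = Measure.addHaar := by
  have hdet : |LinearMap.det ((sunCoordConj N : SUNCoords N ≃ₗ[ℝ] SUNCoords N) : SUNCoords N →ₗ[ℝ] SUNCoords N)| = 1 := by
    have h2 : ((sunCoordConj N : SUNCoords N ≃ₗ[ℝ] SUNCoords N) : SUNCoords N →ₗ[ℝ] SUNCoords N) ∘ₗ
        ((sunCoordConj N : SUNCoords N ≃ₗ[ℝ] SUNCoords N) : SUNCoords N →ₗ[ℝ] SUNCoords N) = LinearMap.id := by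
      apply LinearMap.ext; intro c; exact sunCoordConj_sunCoordConj N c
    have h := congrArg LinearMap.det h2
    rw [LinearMap.det_comp, LinearMap.det_id] at h
    have habs : |LinearMap.det ((sunCoordConj N : SUNCoords N ≃ₗ[ℝ] SUNCoords N) : SUNCoords N →ₗ[ℝ] SUNCoords N)| ^ 2 = 1 := by
      rw [sq_abs, sq, h]
    nlinarith [abs_nonneg (LinearMap.det ((sunCoordConj N : SUNCoords N ≃ₗ[ℝ] SUNCoords N) : SUNCoords N →ₗ[ℝ] SUNCoords N))]
  have hne : LinearMap.det ((sunCoordConj N : SUNCoords N ≃ₗ[ℝ] SUNCoords N) : SUNCoords N →ₗ[ℝ] SUNCoords N) ≠ 0 := by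
    intro h0; rw [h0, abs_zero] at hdet; exact zero_ne_one hdet
  have h := Measure.map_linearMap_addHaar_eq_smul_addHaar (μ := (Measure.addHaar : Measure (SUNCoords N))) hne
  rw [LinearEquiv.coe_coe] at h
  rw [h, abs_inv, hdet, inv_one, ENNReal.ofReal_one, one_smul]

variable {Lk : Type*} [Fintype Lk]

/-- **The momentum conjugation**: the coordinate involution applied link by link, a measurable bijection. -/
def sunMomConj : (Lk → SUNCoords N) ≃ᵐ (Lk → SUNCoords N) where
  toFun p := fun l => sunCoordConj N (p l)
  invFun p := fun l => sunCoordConj N (p l)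
  left_inv p := by funext l; exact sunCoordConj_sunCoordConj N (p l)
  right_inv p := by funext l; exact sunCoordConj_sunCoordConj N (p l)
  measurable_toFun := measurable_pi_lambda _ fun l =>
    (sunCoordConj N).toContinuousLinearEquiv.continuous.measurable.comp (measurable_pi_apply l)
  measurable_invFun := measurable_pi_lambda _ fun l =>
    (sunCoordConj N).toContinuousLinearEquiv.continuous.measurable.comp (measurable_pi_apply l)

omit [Fintype Lk] in
/-- `sunMomConj` evaluated. -/
@[simp] theorem sunMomConj_apply (p : Lk → SUNCoords N) (l : Lk) : sunMomConj N p l = sunCoordConj N (p l) := rfl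

/-- Product Lebesgue measure on the momenta is preserved. -/
theorem map_sunMomConj_pi :
    (Measure.pi fun _ : Lk => (Measure.addHaar : Measure (SUNCoords N))).map (sunMomConj N) =
      Measure.pi fun _ : Lk => (Measure.addHaar : Measure (SUNCoords N)) :=
  (measurePreserving_pi (fun _ : Lk => (Measure.addHaar : Measure (SUNCoords N)))
    (fun _ : Lk => (Measure.addHaar : Measure (SUNCoords N)))
    (fun _ => ⟨(sunCoordConj N).toContinuousLinearEquiv.continuous.measurable, map_sunCoordConj_addHaar N⟩)).map_eq

/-- **The momentum refresh law is conjugation invariant.** -/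
theorem sunMomentumLaw_map_sunMomConj :
    (sunMomentumLaw (L := Lk) (Measure.addHaar : Measure (SUNCoords N)) (sunKinetic N)).map (sunMomConj N) =
      sunMomentumLaw (Measure.addHaar : Measure (SUNCoords N)) (sunKinetic N) := by
  unfold sunMomentumLaw sunMomentumWeight
  rw [Measure.map_smul]
  congr 1
  exact withDensity_map_of_measurableEquiv _ (sunMomConj N) _ (map_sunMomConj_pi N) fun p => by
    show ENNReal.ofReal (Real.exp (-sunKinetic N (fun l => sunCoordConj N (p l)))) = _
    rw [sunKinetic_sunCoordConj]

/-! ## §2 The `n`-step proposal and the kernel commute with charge conjugation -/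

section Proposal

variable {Lk : Type*} (ε : ℝ) {g : (Lk → Matrix.specialUnitaryGroup (Fin N) ℂ) → Lk → SUNCoords N}

/-- The group drift commutes with conjugation: `e^{ε ι(R p_l)} · conj(U_l) = conj(e^{ε ι p_l} · U_l)`. -/
theorem sunExpDrift_configConj (p : Lk → SUNCoords N) (U : Lk → Matrix.specialUnitaryGroup (Fin N) ℂ) :
    sunExpDrift (sunCoordι N) (sunCoordι_skew N) ε (fun l => sunCoordConj N (p l)) * (fun l => suConjAut N (U l)) =
      fun l => suConjAut N ((sunExpDrift (sunCoordι N) (sunCoordι_skew N) ε p * U) l) := by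
  funext l
  simp only [Pi.mul_apply, sunExpDrift, map_mul, ← suExp_sunCoordConj, map_smul]

/-- **The `n`-step proposal commutes with charge conjugation** for every conjugation-equivariant increment
(`g(Ū) = R ∘ g(U)`): `Ψ_n(Ū, R∘p) = (conj Ψ_n(U,p)₁, R ∘ Ψ_n(U,p)₂)`. -/
theorem sunLeapfrogProposalN_configConj (hgc : ∀ U, g (fun l => suConjAut N (U l)) = fun l => sunCoordConj N (g U l)) (n : ℕ)
    (z : (Lk → Matrix.specialUnitaryGroup (Fin N) ℂ) × (Lk → SUNCoords N)) :
    sunLeapfrogProposalN (sunCoordι N) (sunCoordι_skew N) ε g n (fun l => suConjAut N (z.1 l), fun l => sunCoordConj N (z.2 l)) =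
      (fun l => suConjAut N ((sunLeapfrogProposalN (sunCoordι N) (sunCoordι_skew N) ε g n z).1 l),
        fun l => sunCoordConj N ((sunLeapfrogProposalN (sunCoordι N) (sunCoordι_skew N) ε g n z).2 l)) := by
  set Tc : (Lk → Matrix.specialUnitaryGroup (Fin N) ℂ) × (Lk → SUNCoords N) →
      (Lk → Matrix.specialUnitaryGroup (Fin N) ℂ) × (Lk → SUNCoords N) :=
    fun z => (fun l => suConjAut N (z.1 l), fun l => sunCoordConj N (z.2 l)) with hTc
  have hkick : Function.Semiconj Tc (⇑(kick g)) (⇑(kick g)) := by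
    intro z
    simp only [hTc, kick, Equiv.coe_fn_mk, hgc]
    refine Prod.ext rfl ?_
    funext l
    simp only [Pi.add_apply, map_add]
  have hdrift : Function.Semiconj Tc (⇑(drift (mulDrift (sunExpDrift (sunCoordι N) (sunCoordι_skew N) ε))))
      (⇑(drift (mulDrift (sunExpDrift (sunCoordι N) (sunCoordι_skew N) ε)))) := by
    intro z
    simp only [hTc, drift, mulDrift, Equiv.coe_fn_mk, Equiv.coe_mulLeft]
    refine Prod.ext ?_ rfl
    exact (sunExpDrift_configConj N ε z.2 z.1).symm
  have hflip : Function.Semiconj Tc (⇑(flip : Equiv.Perm ((Lk → Matrix.specialUnitaryGroup (Fin N) ℂ) × (Lk → SUNCoords N))))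
      (⇑(flip : Equiv.Perm ((Lk → Matrix.specialUnitaryGroup (Fin N) ℂ) × (Lk → SUNCoords N)))) := by
    intro z
    simp only [hTc, flip_apply]
    refine Prod.ext rfl ?_
    funext l
    simp only [Pi.neg_apply, map_neg]
  have hword : Function.Semiconj Tc (⇑(sunLeapfrogProposalN (sunCoordι N) (sunCoordι_skew N) ε g n))
      (⇑(sunLeapfrogProposalN (sunCoordι N) (sunCoordι_skew N) ε g n)) := by
    unfold sunLeapfrogProposalN palindromicWord
    simp only [List.reverse_singleton, List.prod_singleton, Equiv.Perm.coe_mul, Equiv.Perm.coe_pow]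
    exact hflip.comp_right (((hkick.comp_right hdrift).comp_right hkick).iterate_right n)
  exact (hword z).symm

variable [Fintype Lk] (hg : Measurable g)

/-- **THE ENGINE KERNEL COMMUTES WITH CHARGE CONJUGATION** for every conjugation-equivariant increment and every measurable
action with `S(Ū) = S(U)`: `conjKernel (sunLeapfrogHMCN …) (configConj) = sunLeapfrogHMCN …` (the configuration symmetry given as
any measurable bijection `Θ` acting as link-wise conjugation). -/
theorem conjKernel_sunLeapfrogHMCN_of_configConj {S : (Lk → Matrix.specialUnitaryGroup (Fin N) ℂ) → ℝ} (hS : Measurable S)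
    (Θ : (Lk → Matrix.specialUnitaryGroup (Fin N) ℂ) ≃ᵐ (Lk → Matrix.specialUnitaryGroup (Fin N) ℂ))
    (hΘ : ∀ U, Θ U = fun l => suConjAut N (U l))
    (hgc : ∀ U, g (fun l => suConjAut N (U l)) = fun l => sunCoordConj N (g U l))
    (hSc : ∀ U, S (fun l => suConjAut N (U l)) = S U) (n : ℕ) :
    conjKernel (sunLeapfrogHMCN (sunCoordι N) (sunCoordι_skew N) ε (Measure.addHaar : Measure (SUNCoords N)) (sunKinetic N) hg S n) Θ =
      sunLeapfrogHMCN (sunCoordι N) (sunCoordι_skew N) ε (Measure.addHaar : Measure (SUNCoords N)) (sunKinetic N) hg S n := by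
  unfold sunLeapfrogHMCN
  refine conjKernel_refreshUpdate_eq_self _ _ Θ (sunMomConj N) (sunMomentumLaw_map_sunMomConj N)
    (conjKernel_involMH_of_comm ((hS.comp measurable_fst).add ((measurable_sunKinetic N).comp measurable_snd)) _
      (fun z => ?_) (fun z => ?_))
  · show sunLeapfrogProposalN (sunCoordι N) (sunCoordι_skew N) ε g n (Θ z.1, sunMomConj N z.2) =
      (Θ (sunLeapfrogProposalN (sunCoordι N) (sunCoordι_skew N) ε g n z).1,
        sunMomConj N (sunLeapfrogProposalN (sunCoordι N) (sunCoordι_skew N) ε g n z).2)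
    rw [hΘ, hΘ]
    exact sunLeapfrogProposalN_configConj N ε hgc n z
  · show S (Θ z.1) + sunKinetic N (sunMomConj N z.2) = S z.1 + sunKinetic N z.2
    rw [hΘ, hSc]
    exact congrArg _ (sunKinetic_sunCoordConj N z.2)

end Proposal

/-! ## §3 The two arms as run -/

section Arms

variable {d L : ℕ} [NeZero L]

omit [NeZero L] in
/-- **The Wilson force is conjugation equivariant**: `F(Ū)_e = R (F(U)_e)`. -/
theorem sunWilsonForce_configConj (β : ℝ) (U : GaugeConfig d L (Matrix.specialUnitaryGroup (Fin N) ℂ)) :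
    sunWilsonForce N β (configConj N U) = fun e => sunCoordConj N (sunWilsonForce N β U e) := by
  funext e
  simp only [sunWilsonForce, map_smul]
  rw [Scoring.plaquetteLoopSum_configConj, Scoring.suProj_mapConj,
    coordOf_mapConj N _ (conjTranspose_suProj _) (trace_suProj _)]

omit [NeZero L] in
/-- **Every plaquette-weighted loop sum is conjugation equivariant**: `Ω^w(Ū) = conj Ω^w(U)`. -/
theorem weightedLoopSum_configConj (w : Plaquette d L → ℝ) (V : GaugeConfig d L (Matrix.specialUnitaryGroup (Fin N) ℂ))
    (x : Site d L) (μ : Fin d) :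
    weightedLoopSum w (configConj N V) x μ = 𝐂 (weightedLoopSum w V x μ) := by
  unfold weightedLoopSum
  rw [map_sum]
  refine Finset.sum_congr rfl fun ν _ => ?_
  split_ifs with h
  · rw [RingHom.map_zero]
  · rw [map_add, plaquetteHolonomy_configConj, plaquetteHolonomy_configConj, Scoring.mapConj_real_smul, Scoring.mapConj_real_smul]
    simp only [configConj, configAut_apply, ← map_inv, ← map_mul, Scoring.coe_suConjAut]

omit [NeZero L] in
/-- **The open-boundary force (any plaquette weights) is conjugation equivariant.** -/
theorem sunWeightedForce_configConj (w : Plaquette d L → ℝ) (β : ℝ) (U : GaugeConfig d L (Matrix.specialUnitaryGroup (Fin N) ℂ)) :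
    sunWeightedForce N w β (configConj N U) = fun e => sunCoordConj N (sunWeightedForce N w β U e) := by
  funext e
  simp only [sunWeightedForce, map_smul]
  rw [weightedLoopSum_configConj, Scoring.suProj_mapConj, coordOf_mapConj N _ (conjTranspose_suProj _) (trace_suProj _)]

/-- **THE PERIODIC HMC ARM AS RUN COMMUTES WITH CHARGE CONJUGATION** (every `β, ε, nstep, L`). -/
theorem conjKernel_wilsonForce_sunLeapfrogHMCN_configConj (β ε : ℝ) (nstep : ℕ) :
    conjKernel (sunLeapfrogHMCN (sunCoordι N) (sunCoordι_skew N) ε (Measure.addHaar : Measure (SUNCoords N)) (sunKinetic N)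
        (measurable_halfKick_sun N (measurable_sunWilsonForce N (d := d) (L := L) β) ε)
        (fun U => β * wilsonAction (suRep N) U) nstep) (configConj N) =
      sunLeapfrogHMCN (sunCoordι N) (sunCoordι_skew N) ε (Measure.addHaar : Measure (SUNCoords N)) (sunKinetic N)
        (measurable_halfKick_sun N (measurable_sunWilsonForce N (d := d) (L := L) β) ε)
        (fun U => β * wilsonAction (suRep N) U) nstep :=
  conjKernel_sunLeapfrogHMCN_of_configConj N ε (measurable_halfKick_sun N (measurable_sunWilsonForce N β) ε)
    ((continuous_smul_wilsonAction (suRep N) continuous_suRep β).measurable) (configConj N) (fun U => rfl)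
    (fun U => by
      show (-(ε / 2)) • sunWilsonForce N β (configConj N U) = _
      rw [sunWilsonForce_configConj]; funext l; simp only [Pi.smul_apply, map_smul])
    (fun U => by
      show β * wilsonAction (suRep N) (configConj N U) = _
      exact congrArg (fun r => β * r)
        (wilsonAction_configAut (φ := suConjAut N) (ρ := suRep N) (fun g => re_trace_fundamentalRep_suConjAut N g) U))
    nstep

/-- **THE OPEN-BOUNDARY HMC ARM AS RUN COMMUTES WITH CHARGE CONJUGATION** (every `τ, β, ε, nstep, L`). -/
theorem conjKernel_obcForce_sunLeapfrogHMCN_configConj (τ : Fin d) (β ε : ℝ) (nstep : ℕ) :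
    conjKernel (sunLeapfrogHMCN (sunCoordι N) (sunCoordι_skew N) ε (Measure.addHaar : Measure (SUNCoords N)) (sunKinetic N)
        (measurable_halfKick_sun N (measurable_sunWeightedForce N (d := d) (L := L) (obcWeight τ) β) ε)
        (fun U => β * obcAction (suRep N) τ U) nstep) (configConj N) =
      sunLeapfrogHMCN (sunCoordι N) (sunCoordι_skew N) ε (Measure.addHaar : Measure (SUNCoords N)) (sunKinetic N)
        (measurable_halfKick_sun N (measurable_sunWeightedForce N (d := d) (L := L) (obcWeight τ) β) ε)
        (fun U => β * obcAction (suRep N) τ U) nstep :=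
  conjKernel_sunLeapfrogHMCN_of_configConj N ε (measurable_halfKick_sun N (measurable_sunWeightedForce N (obcWeight τ) β) ε)
    ((continuous_obcAction (suRep N) continuous_suRep τ).measurable.const_mul β) (configConj N) (fun U => rfl)
    (fun U => by
      show (-(ε / 2)) • sunWeightedForce N (obcWeight τ) β (configConj N U) = _
      rw [sunWeightedForce_configConj]; funext l; simp only [Pi.smul_apply, map_smul])
    (fun U => by
      show β * obcAction (suRep N) τ (configConj N U) = _
      exact congrArg (fun r => β * r)
        (obcAction_configAut (φ := suConjAut N) (ρ := suRep N) (fun g => re_trace_fundamentalRep_suConjAut N g) τ U))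
    nstep

end Arms

/-! ## §4 At every step from the cold or hot start: `E_t[Im tr W] = 0` for conjugation-equivariant field functions -/

section ImTrace

variable {d L : ℕ} [NeZero L]

omit [NeZero L] in
/-- **Order-parameter mechanism for conjugation**: under a law invariant under `configConj`, every `SU(N)`-valued field function
`W` with `W(Ū) = conj W(U)` has `E[Im tr W] = 0` (no integrability needed). -/
theorem integral_im_trace_eq_zero_of_map_configConj {μ : Measure (GaugeConfig d L (Matrix.specialUnitaryGroup (Fin N) ℂ))}
    (hμ : μ.map (configConj N) = μ)
    {W : GaugeConfig d L (Matrix.specialUnitaryGroup (Fin N) ℂ) → Matrix.specialUnitaryGroup (Fin N) ℂ}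
    (hW : ∀ U, W (configConj N U) = suConjAut N (W U)) :
    ∫ U, (fundamentalRep (Fin N) (W U)).trace.im ∂μ = 0 :=
  Scoring.integral_eq_zero_of_measurePreserving_odd (configConj N) ⟨(configConj N).measurable, hμ⟩
    (fun U => im_trace_odd_of_configConj_equivariant N hW U)

/-- **PERIODIC RUN**: from any conjugation-invariant start, at every step `t`, `E_t[Im tr W] = 0` for every conjugation-equivariant
`W` (links, plaquette holonomies, straight / Polyakov lines …). -/
theorem integral_wilsonHmcChain_im_trace_eq_zero_of_equivariant (β ε : ℝ) (nstep : ℕ)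
    {μ₀ : Measure (GaugeConfig d L (Matrix.specialUnitaryGroup (Fin N) ℂ))} (hμ₀ : μ₀.map (configConj N) = μ₀) (t : ℕ)
    {W : GaugeConfig d L (Matrix.specialUnitaryGroup (Fin N) ℂ) → Matrix.specialUnitaryGroup (Fin N) ℂ}
    (hW : ∀ U, W (configConj N U) = suConjAut N (W U)) :
    ∫ U, (fundamentalRep (Fin N) (W U)).trace.im ∂(μ₀.bind (nHit (sunLeapfrogHMCN (sunCoordι N) (sunCoordι_skew N) ε
        (Measure.addHaar : Measure (SUNCoords N)) (sunKinetic N)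
        (measurable_halfKick_sun N (measurable_sunWilsonForce N (d := d) (L := L) β) ε)
        (fun U => β * wilsonAction (suRep N) U) nstep) t)) = 0 :=
  integral_im_trace_eq_zero_of_map_configConj N
    (Scoring.map_bind_nHit_eq_self (conjKernel_wilsonForce_sunLeapfrogHMCN_configConj N β ε nstep) hμ₀ t) hW

/-- **OPEN-BOUNDARY RUN**: the same for the open-boundary arm (every `τ`). -/
theorem integral_obcHmcChain_im_trace_eq_zero_of_equivariant (τ : Fin d) (β ε : ℝ) (nstep : ℕ)
    {μ₀ : Measure (GaugeConfig d L (Matrix.specialUnitaryGroup (Fin N) ℂ))} (hμ₀ : μ₀.map (configConj N) = μ₀) (t : ℕ)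
    {W : GaugeConfig d L (Matrix.specialUnitaryGroup (Fin N) ℂ) → Matrix.specialUnitaryGroup (Fin N) ℂ}
    (hW : ∀ U, W (configConj N U) = suConjAut N (W U)) :
    ∫ U, (fundamentalRep (Fin N) (W U)).trace.im ∂(μ₀.bind (nHit (sunLeapfrogHMCN (sunCoordι N) (sunCoordι_skew N) ε
        (Measure.addHaar : Measure (SUNCoords N)) (sunKinetic N)
        (measurable_halfKick_sun N (measurable_sunWeightedForce N (d := d) (L := L) (obcWeight τ) β) ε)
        (fun U => β * obcAction (suRep N) τ U) nstep) t)) = 0 :=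
  integral_im_trace_eq_zero_of_map_configConj N
    (Scoring.map_bind_nHit_eq_self (conjKernel_obcForce_sunLeapfrogHMCN_configConj N τ β ε nstep) hμ₀ t) hW

/-- **COLD START, PERIODIC RUN: `E_t[Im tr P] = 0` for every straight / Polyakov line at every step.** -/
theorem integral_wilsonHmcColdStart_im_trace_lineHolonomy_eq_zero (β ε : ℝ) (nstep t : ℕ) (k : Fin d) (m : ℕ) (y : Site d L) :
    ∫ U, (fundamentalRep (Fin N) (lineHolonomy U k m y)).trace.im
      ∂((Measure.dirac (1 : GaugeConfig d L (Matrix.specialUnitaryGroup (Fin N) ℂ))).bind (nHit (sunLeapfrogHMCN (sunCoordι N)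
        (sunCoordι_skew N) ε (Measure.addHaar : Measure (SUNCoords N)) (sunKinetic N)
        (measurable_halfKick_sun N (measurable_sunWilsonForce N (d := d) (L := L) β) ε)
        (fun U => β * wilsonAction (suRep N) U) nstep) t)) = 0 :=
  integral_wilsonHmcChain_im_trace_eq_zero_of_equivariant N β ε nstep Scoring.dirac_one_map_configConj t
    fun U => lineHolonomy_configConj N U k m y

/-- **HOT START, PERIODIC RUN: `E_t[Im tr P] = 0` for every straight / Polyakov line at every step.** -/
theorem integral_wilsonHmcHotStart_im_trace_lineHolonomy_eq_zero (β ε : ℝ) (nstep t : ℕ) (k : Fin d) (m : ℕ) (y : Site d L) :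
    ∫ U, (fundamentalRep (Fin N) (lineHolonomy U k m y)).trace.im
      ∂((Measure.pi fun _ : Edge d L => haarProbability (Matrix.specialUnitaryGroup (Fin N) ℂ)).bind (nHit (sunLeapfrogHMCN
        (sunCoordι N) (sunCoordι_skew N) ε (Measure.addHaar : Measure (SUNCoords N)) (sunKinetic N)
        (measurable_halfKick_sun N (measurable_sunWilsonForce N (d := d) (L := L) β) ε)
        (fun U => β * wilsonAction (suRep N) U) nstep) t)) = 0 :=
  integral_wilsonHmcChain_im_trace_eq_zero_of_equivariant N β ε nstep Scoring.piHaar_map_configConj t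
    fun U => lineHolonomy_configConj N U k m y

/-- **COLD START, OPEN-BOUNDARY RUN: `E_t[Im tr P] = 0` for every straight line at every step.** -/
theorem integral_obcHmcColdStart_im_trace_lineHolonomy_eq_zero (τ : Fin d) (β ε : ℝ) (nstep t : ℕ) (k : Fin d) (m : ℕ)
    (y : Site d L) :
    ∫ U, (fundamentalRep (Fin N) (lineHolonomy U k m y)).trace.im
      ∂((Measure.dirac (1 : GaugeConfig d L (Matrix.specialUnitaryGroup (Fin N) ℂ))).bind (nHit (sunLeapfrogHMCN (sunCoordι N)
        (sunCoordι_skew N) ε (Measure.addHaar : Measure (SUNCoords N)) (sunKinetic N)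
        (measurable_halfKick_sun N (measurable_sunWeightedForce N (d := d) (L := L) (obcWeight τ) β) ε)
        (fun U => β * obcAction (suRep N) τ U) nstep) t)) = 0 :=
  integral_obcHmcChain_im_trace_eq_zero_of_equivariant N τ β ε nstep Scoring.dirac_one_map_configConj t
    fun U => lineHolonomy_configConj N U k m y

/-- **HOT START, OPEN-BOUNDARY RUN: `E_t[Im tr P] = 0` for every straight line at every step.** -/
theorem integral_obcHmcHotStart_im_trace_lineHolonomy_eq_zero (τ : Fin d) (β ε : ℝ) (nstep t : ℕ) (k : Fin d) (m : ℕ)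
    (y : Site d L) :
    ∫ U, (fundamentalRep (Fin N) (lineHolonomy U k m y)).trace.im
      ∂((Measure.pi fun _ : Edge d L => haarProbability (Matrix.specialUnitaryGroup (Fin N) ℂ)).bind (nHit (sunLeapfrogHMCN
        (sunCoordι N) (sunCoordι_skew N) ε (Measure.addHaar : Measure (SUNCoords N)) (sunKinetic N)
        (measurable_halfKick_sun N (measurable_sunWeightedForce N (d := d) (L := L) (obcWeight τ) β) ε)
        (fun U => β * obcAction (suRep N) τ U) nstep) t)) = 0 :=
  integral_obcHmcChain_im_trace_eq_zero_of_equivariant N τ β ε nstep Scoring.piHaar_map_configConj t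
    fun U => lineHolonomy_configConj N U k m y

end ImTrace

end Summit.Ventures.LatticeQCDFlow.Exactness
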